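import Summits.AtomisticToContinuum.Crystallization.Theorems.OverbindingBudgetAffineFarFieldCellTRDCubic
import Summits.AtomisticToContinuum.Crystallization.Theorems.OverbindingBudgetAffineFarFieldCellFacets

/-!
# Overbinding budget — far-field Voronoi cells, part 27V-T «CellFacetsTRD»: facet prisms of the `h`-cell

Route `OverbindingBudget`, crux `RobustDefectLimitWindows` (stmt-31280), line (2c), leaf SW♭(30),
part 27V-T, convention-bound half of item T4 for the `h`-cell (critic ★ r1738 (B)/(τ) «T4 SHAPE OF
RECORD: parallelogram prism per facet; rd 12 rhombi exact; trd trapezoids in the edge parallelogram,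
area ×4/3»).  Companion of «CellFacets» (the `k`-cell).  The ideal `h`-cell `trdCell h` (trapezo-rhombic
dodecahedron, part 27Vb-K(B2): the closed upper half `Σx ≥ 0` of `rdCell h` glued to the half-turned
lower half) has twelve bonds `v = (2h/3)·w`, `w ∈ hcpInt` (`‖v‖² = 8h²`, facet plane `⟪x, v⟫ = 4h²`):
* three UPPER rhombi (`w` a permutation of `(3,3,0)`, `v = 2h·(1,1,0)`…): the cap of `trdCell h` IS the
  cap of `rdCell h` once `ε < 1/3` (the half-turned lower half does not reach it), §1;
* three LOWER rhombi (`w` a permutation of `(-1,-1,-4)`, `v = halfTurn (2h·(-1,-1,0))`): the cap is the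
  half-turn of a cap of `rdCell h` once `ε < 1/3`, §2;
* six EQUATORIAL TRAPEZOIDS (`w` a permutation of `(3,-3,0)`, `v = 2h·(1,-1,0)`): vertices
  `A = (2h,0,0)`, `B = (h,-h,h)`, `F = (h/3,-5h/3,h/3)`, `E = (2h/3,-4h/3,-4h/3)` (`AE ∥ BF ∥ (1,1,1)`,
  `B = E + (A - E)/2 + (F - E)`); the cap lies in the prism on the EDGE PARALLELOGRAM
  `E + [0,1](A - E) + [0,1](F - E)` (area `4/3` of the trapezoid): frame `eqFrame h` with columns
  `A - E = (4h/3)(1,1,1)`, `F - E = (h/3)(-1,-1,5)`, `h(1,-1,0)`, `|det| = 16h³/3`, lower row `√2·h`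
  (Gram matrix `h²[[16/3,4/3,0],[4/3,3,0],[0,0,2]]`), and the SAME box `[-ε/2, 1+ε/2]² × [-ε, 0]` as the
  rhombi, for every `ε` (§3: explicit inverse coordinates, bounded separately on the two halves of
  the cell by one pair of `rdCell` inequalities — for `x` resp. `halfTurn x` — and the cap inequality).
The transport over the twelve bonds (coordinate permutations `cycIso`, `swapIso`) and the assembled
statement for `w ∈ hcpInt` are in «CellFacetsHCP».  Pure analysis on `ℝ³`, atlas-free.
-/

namespace Summit.AtomisticToContinuum.Crystallization.Theorems.OverbindingBudgetAffineFarFieldCellFacetsTRD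

noncomputable section

open Set MeasureTheory Metric
open scoped Pointwise
open Literature.Geometry.DiscreteGeometry (intVec intVec_apply fccInt hcpInt)
open Summit.AtomisticToContinuum.Crystallization.Theorems.OverbindingBudgetAffineFarFieldCellRD
open Summit.AtomisticToContinuum.Crystallization.Theorems.OverbindingBudgetAffineFarFieldCellSymm
open Summit.AtomisticToContinuum.Crystallization.Theorems.OverbindingBudgetAffineFarFieldCellTwist
open Summit.AtomisticToContinuum.Crystallization.Theorems.OverbindingBudgetAffineFarFieldCellTRD
open Summit.AtomisticToContinuum.Crystallization.Theorems.OverbindingBudgetAffineFarFieldCellTRDCubic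
open Summit.AtomisticToContinuum.Crystallization.Theorems.OverbindingBudgetAffineFarFieldCellFacets

local notation "E3" => EuclideanSpace ℝ (Fin 3)

/-! ## §0 The two halves of the `h`-cell, the half-turn, the bonds -/

/-- The pairing with a scaled integer vector, in coordinates. -/
theorem inner_smul_intVec_fin3 (c : ℝ) (x : E3) (w : Fin 3 → ℤ) :
    inner ℝ x (c • intVec w) = c * ((w 0 : ℝ) * x 0 + (w 1 : ℝ) * x 1 + (w 2 : ℝ) * x 2) := by
  rw [real_inner_smul_right]
  simp only [EuclideanSpace.inner_eq_star_dotProduct, dotProduct, Fin.sum_univ_three, intVec_apply,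
    star_trivial]

/-- Dividing a cap inequality `4h²(1 - ε) ≤ 2h·E` by `2h > 0`. -/
theorem cap_div_bond {h ε E : ℝ} (hh : 0 < h) (H : 4 * h ^ 2 * (1 - ε) ≤ 2 * h * E) :
    2 * h * (1 - ε) ≤ E :=
  le_of_mul_le_mul_left (by linarith [H]) (by positivity : (0 : ℝ) < 2 * h)

/-- The two closed halves of the `h`-cell, pointwise: the upper half of the `k`-cell, or a point of
the lower half-space whose half-turn lies in the `k`-cell. -/
theorem mem_trdCell_cases {h : ℝ} {x : E3} (hx : x ∈ trdCell h) :
    (x ∈ rdCell h ∧ 0 ≤ x 0 + x 1 + x 2) ∨ (halfTurn x ∈ rdCell h ∧ x 0 + x 1 + x 2 ≤ 0) := by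
  rw [trdCell_eq_union] at hx
  simpa only [mem_union, mem_inter_iff, mem_setOf_eq, mem_preimage, axSumL_apply] using hx

/-- The half-turn is self-adjoint (an isometric involution). -/
theorem inner_halfTurn_left (x v : E3) : inner ℝ (halfTurn x) v = inner ℝ x (halfTurn v) := by
  rw [← halfTurn.inner_map_map (halfTurn x) v, halfTurn_halfTurn]

/-- A point whose half-turn lies in `S` lies in the half-turn image of `S`. -/
theorem mem_image_halfTurn {S : Set E3} {x : E3} (hx : halfTurn x ∈ S) : x ∈ halfTurn '' S :=
  ⟨halfTurn x, hx, halfTurn_halfTurn x⟩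

/-- The upper hcp bond `(2h/3)(3,3,0)` is the fcc bond `2h(1,1,0)`. -/
theorem hcpBond_up (h : ℝ) : (2 * h / 3) • intVec ![3, 3, 0] = (2 * h) • intVec ![1, 1, 0] := by
  ext i
  fin_cases i <;> simp [intVec_apply]

/-- The equatorial hcp bond `(2h/3)(3,-3,0)` is the fcc bond `2h(1,-1,0)`. -/
theorem hcpBond_eq (h : ℝ) : (2 * h / 3) • intVec ![3, -3, 0] = (2 * h) • intVec ![1, -1, 0] := by
  ext i
  fin_cases i <;> simp [intVec_apply]

/-- The lower hcp bond `(2h/3)(-1,-1,-4)` is the half-turn of the fcc bond `2h(-1,-1,0)`. -/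
theorem hcpBond_low (h : ℝ) :
    (2 * h / 3) • intVec ![-1, -1, -4] = halfTurn ((2 * h) • intVec ![-1, -1, 0]) := by
  ext i
  fin_cases i <;> simp [intVec_apply] <;> ring

/-! ## §1 The three upper rhombi -/

/-- ★ UPPER CAP: for `ε < 1/3` the cap of the `h`-cell at the upper bond `(2h/3)(3,3,0) = 2h(1,1,0)` is
contained in the cap of the `k`-cell at the same bond (a point of the lower half with its half-turn
in `rdCell h` has `x₀ + x₁ ≤ 4h/3 < 2h(1 - ε)`). -/
theorem trdCell_upCap_subset {h ε : ℝ} (hh : 0 < h) (hε : ε < 1 / 3) :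
    trdCell h ∩ {x | 4 * h ^ 2 * (1 - ε) ≤ inner ℝ x ((2 * h / 3) • intVec ![3, 3, 0])} ⊆
      rdCell h ∩ {x | 4 * h ^ 2 * (1 - ε) ≤ inner ℝ x ((2 * h) • intVec ![1, 1, 0])} := by
  rintro x ⟨hx, hcap⟩
  rw [mem_setOf_eq, hcpBond_up] at hcap
  refine ⟨?_, hcap⟩
  rcases mem_trdCell_cases hx with ⟨hrd, -⟩ | ⟨hrd, hS⟩
  · exact hrd
  · exfalso
    rw [inner_two_h_intVec] at hcap
    simp only [Matrix.cons_val_zero, Matrix.cons_val_one, Matrix.cons_val_two, Matrix.head_cons,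
      Matrix.tail_cons, Int.cast_one, Int.cast_zero] at hcap
    have hc := cap_div_bond hh hcap
    obtain ⟨h01, h02, h12⟩ := mem_rdCell_iff.1 hrd
    have e0 := halfTurn_apply x 0
    have e1 := halfTurn_apply x 1
    have e2 := halfTurn_apply x 2
    have hεh : h * ε < h * (1 / 3) := mul_lt_mul_of_pos_left hε hh
    linarith [neg_abs_le (halfTurn x 0), neg_abs_le (halfTurn x 1), le_abs_self (halfTurn x 2)]

/-! ## §2 The three lower rhombi -/

/-- ★ LOWER CAP: for `ε < 1/3` the cap of the `h`-cell at the lower bond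
`(2h/3)(-1,-1,-4) = halfTurn (2h(-1,-1,0))` is contained in the half-turn of the cap of the `k`-cell
at `2h(-1,-1,0)` (a point of the upper half in `rdCell h` has `⟪x, v⟫ ≤ 8h²/3 < 4h²(1 - ε)`). -/
theorem trdCell_lowCap_subset {h ε : ℝ} (hh : 0 < h) (hε : ε < 1 / 3) :
    trdCell h ∩ {x | 4 * h ^ 2 * (1 - ε) ≤ inner ℝ x ((2 * h / 3) • intVec ![-1, -1, -4])} ⊆
      halfTurn ''
        (rdCell h ∩ {x | 4 * h ^ 2 * (1 - ε) ≤ inner ℝ x ((2 * h) • intVec ![-1, -1, 0])}) := by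
  rintro x ⟨hx, hcap⟩
  rw [mem_setOf_eq, hcpBond_low, ← inner_halfTurn_left] at hcap
  rcases mem_trdCell_cases hx with ⟨hrd, hS⟩ | ⟨hrd, -⟩
  · exfalso
    rw [inner_two_h_intVec] at hcap
    simp only [Matrix.cons_val_zero, Matrix.cons_val_one, Matrix.cons_val_two, Matrix.head_cons,
      Matrix.tail_cons, Int.cast_one, Int.cast_zero, Int.cast_neg] at hcap
    have hc := cap_div_bond hh hcap
    obtain ⟨h01, h02, h12⟩ := mem_rdCell_iff.1 hrd
    have e0 := halfTurn_apply x 0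
    have e1 := halfTurn_apply x 1
    have hεh : h * ε < h * (1 / 3) := mul_lt_mul_of_pos_left hε hh
    linarith [le_abs_self (x 0), le_abs_self (x 1), neg_abs_le (x 2)]
  · exact mem_image_halfTurn ⟨hrd, hcap⟩

/-- Transport of a prism containment along a linear isometry (image form). -/
theorem image_subset_prism (g : E3 ≃ₗᵢ[ℝ] E3) {S B : Set E3} {p : E3} {T : E3 →L[ℝ] E3}
    (h : S ⊆ (fun x => p + T x) '' B) :
    g '' S ⊆ (fun x => g p + (g.toLinearIsometry.toContinuousLinearMap.comp T) x) '' B := by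
  rintro _ ⟨x, hx, rfl⟩
  obtain ⟨b, hb, hbx⟩ := h hx
  refine ⟨b, hb, ?_⟩
  show g p + (g.toLinearIsometry.toContinuousLinearMap.comp T) b = g x
  rw [← hbx, ContinuousLinearMap.comp_apply, isometry_clm_apply, map_add]

/-! ## §3 The six equatorial trapezoids -/

/-- support: the EQUATORIAL FACET FRAME of the `h`-cell at the bond `2h(1,-1,0)`: columns
`A - E = (4h/3)(1,1,1)`, `F - E = (h/3)(-1,-1,5)` (edges of the edge parallelogram at `E`) and
`h(1,-1,0)` (facet normal). -/
def eqFrame (h : ℝ) : E3 →L[ℝ] E3 :=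
  columnFrame ((4 * h / 3) • intVec ![1, 1, 1]) ((h / 3) • intVec ![-1, -1, 5]) (h • intVec ![1, -1, 0])

/-- The equatorial frame in coordinates. -/
theorem eqFrame_apply (h : ℝ) (x : E3) :
    eqFrame h x 0 = 4 * h / 3 * x 0 - h / 3 * x 1 + h * x 2 ∧
      eqFrame h x 1 = 4 * h / 3 * x 0 - h / 3 * x 1 - h * x 2 ∧
      eqFrame h x 2 = 4 * h / 3 * x 0 + 5 * h / 3 * x 1 := by
  refine ⟨?_, ?_, ?_⟩ <;>
  · rw [eqFrame, columnFrame_apply]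
    simp only [PiLp.smul_apply, smul_eq_mul, intVec_apply, Matrix.cons_val_zero, Matrix.cons_val_one,
      Matrix.cons_val_two, Matrix.head_cons, Matrix.tail_cons, Int.cast_one, Int.cast_zero,
      Int.cast_neg, Int.cast_ofNat]
    ring

/-- `|det|` of the equatorial frame: `16h³/3 = (4/3)·4h³` (edge parallelogram = `4/3` trapezoid). -/
theorem abs_det_eqFrame (h : ℝ) (hh : 0 ≤ h) : |(eqFrame h).det| = 16 / 3 * h ^ 3 := by
  have e : (eqFrame h).det = 16 / 3 * h ^ 3 := by
    rw [eqFrame, det_columnFrame]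
    simp only [PiLp.smul_apply, smul_eq_mul, intVec_apply, Matrix.cons_val_zero, Matrix.cons_val_one,
      Matrix.cons_val_two, Matrix.head_cons, Matrix.tail_cons, Int.cast_one, Int.cast_zero,
      Int.cast_neg, Int.cast_ofNat]
    ring
  rw [e]
  exact abs_of_nonneg (by positivity)

/-- LOWER ROW of the equatorial frame: `√2·h·‖x‖ ≤ ‖T x‖`
(`‖T x‖² - 2h²‖x‖² = (h²/3)(10x₀² + 8x₀x₁ + 3x₁²) ≥ 0`). -/
theorem lower_row_eqFrame (h : ℝ) (hh : 0 ≤ h) (x : E3) : Real.sqrt 2 * h * ‖x‖ ≤ ‖eqFrame h x‖ := by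
  obtain ⟨e0, e1, e2⟩ := eqFrame_apply h x
  set y := eqFrame h x
  have hx : ‖x‖ ^ 2 = x 0 ^ 2 + x 1 ^ 2 + x 2 ^ 2 := by
    rw [EuclideanSpace.norm_sq_eq, Fin.sum_univ_three]
    simp only [Real.norm_eq_abs, sq_abs]
  have hy : ‖y‖ ^ 2 = y 0 ^ 2 + y 1 ^ 2 + y 2 ^ 2 := by
    rw [EuclideanSpace.norm_sq_eq, Fin.sum_univ_three]
    simp only [Real.norm_eq_abs, sq_abs]
  have key : (Real.sqrt 2 * h * ‖x‖) ^ 2 ≤ ‖y‖ ^ 2 := by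
    rw [mul_pow, mul_pow, Real.sq_sqrt zero_le_two, hx, hy, e0, e1, e2]
    nlinarith [sq_nonneg (h * (5 * x 0 + 2 * x 1)), sq_nonneg (h * x 1)]
  have h0 : 0 ≤ Real.sqrt 2 * h * ‖x‖ := by positivity
  exact (pow_le_pow_iff_left₀ h0 (norm_nonneg _) two_ne_zero).1 key

/-- ★ The EQUATORIAL CAP in its prism: for `0 < h` and any `ε`,
`trdCell h ∩ {4h²(1 - ε) ≤ ⟪x, 2h(1,-1,0)⟫} ⊆ E + eqFrame h '' ([-ε/2, 1 + ε/2]² × [-ε, 0])`,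
`E = (2h/3)(1,-2,-2)`.  Inverse coordinates `a = (5x₀ + 5x₁ + 2x₂ + 6h)/(16h)`,
`b = (2x₂ - x₀ - x₁ + 2h)/(4h)`, `t = (x₀ - x₁ - 2h)/(2h)`; on the upper half each bound is one pair
of `rdCell` inequalities for `x` plus the cap, on the lower half the same for `halfTurn x`. -/
theorem trdCell_eqCap_subset_prism {h : ℝ} (hh : 0 < h) (ε : ℝ) :
    trdCell h ∩ {x | 4 * h ^ 2 * (1 - ε) ≤ inner ℝ x ((2 * h / 3) • intVec ![3, -3, 0])} ⊆
      (fun x => (2 * h / 3) • intVec ![1, -2, -2] + eqFrame h x) ''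
        {x : E3 | ∀ i, ![-(ε / 2), -(ε / 2), -ε] i ≤ x i ∧ x i ≤ ![1 + ε / 2, 1 + ε / 2, 0] i} := by
  rintro x ⟨hx, hcap⟩
  rw [mem_setOf_eq, hcpBond_eq, inner_two_h_intVec] at hcap
  simp only [Matrix.cons_val_zero, Matrix.cons_val_one, Matrix.cons_val_two, Matrix.head_cons,
    Matrix.tail_cons, Int.cast_one, Int.cast_zero, Int.cast_neg] at hcap
  have hc := cap_div_bond hh hcap
  set a : ℝ := (5 * x 0 + 5 * x 1 + 2 * x 2 + 6 * h) / (16 * h) with ha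
  set b : ℝ := (2 * x 2 - x 0 - x 1 + 2 * h) / (4 * h) with hb
  set t : ℝ := (x 0 - x 1 - 2 * h) / (2 * h) with ht
  obtain ⟨h16, h4, h2⟩ : 0 < 16 * h ∧ 0 < 4 * h ∧ 0 < 2 * h := ⟨by positivity, by positivity, by positivity⟩
  have bounds : (-(ε / 2) ≤ a ∧ a ≤ 1 + ε / 2) ∧ (-(ε / 2) ≤ b ∧ b ≤ 1 + ε / 2) ∧ (-ε ≤ t ∧ t ≤ 0) := by
    rw [ha, hb, ht, le_div_iff₀ h16, div_le_iff₀ h16, le_div_iff₀ h4, div_le_iff₀ h4, le_div_iff₀ h2,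
      div_le_iff₀ h2]
    rcases mem_trdCell_cases hx with ⟨hrd, hS⟩ | ⟨hrd, hS⟩
    · obtain ⟨h01, h02, h12⟩ := mem_rdCell_iff.1 hrd
      have a0 := le_abs_self (x 0); have b0 := neg_abs_le (x 0)
      have a1 := le_abs_self (x 1); have b1 := neg_abs_le (x 1)
      have a2 := le_abs_self (x 2); have b2 := neg_abs_le (x 2)
      refine ⟨⟨?_, ?_⟩, ⟨?_, ?_⟩, ⟨?_, ?_⟩⟩ <;> linarith
    · obtain ⟨h01, h02, h12⟩ := mem_rdCell_iff.1 hrd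
      have e0 := halfTurn_apply x 0
      have e1 := halfTurn_apply x 1
      have e2 := halfTurn_apply x 2
      have a0 := le_abs_self (halfTurn x 0); have b0 := neg_abs_le (halfTurn x 0)
      have a1 := le_abs_self (halfTurn x 1); have b1 := neg_abs_le (halfTurn x 1)
      have a2 := le_abs_self (halfTurn x 2); have b2 := neg_abs_le (halfTurn x 2)
      refine ⟨⟨?_, ?_⟩, ⟨?_, ?_⟩, ⟨?_, ?_⟩⟩ <;> linarith
  obtain ⟨⟨la, ua⟩, ⟨lb, ub⟩, ⟨lt, ut⟩⟩ := bounds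
  refine ⟨WithLp.toLp 2 ![a, b, t], ?_, ?_⟩
  · intro i
    fin_cases i
    · exact ⟨la, ua⟩
    · exact ⟨lb, ub⟩
    · exact ⟨lt, ut⟩
  · obtain ⟨e0, e1, e2⟩ := eqFrame_apply h (WithLp.toLp 2 ![a, b, t])
    ext i
    fin_cases i
    · show ((2 * h / 3) • intVec ![1, -2, -2] + eqFrame h (WithLp.toLp 2 ![a, b, t])) 0 = x 0
      rw [PiLp.add_apply, e0]
      simp only [PiLp.smul_apply, smul_eq_mul, intVec_apply, Matrix.cons_val_zero,
        Matrix.cons_val_one, Matrix.cons_val_two, Matrix.head_cons, Matrix.tail_cons, Int.cast_one]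
      rw [ha, hb, ht]; field_simp; ring
    · show ((2 * h / 3) • intVec ![1, -2, -2] + eqFrame h (WithLp.toLp 2 ![a, b, t])) 1 = x 1
      rw [PiLp.add_apply, e1]
      simp only [PiLp.smul_apply, smul_eq_mul, intVec_apply, Matrix.cons_val_zero,
        Matrix.cons_val_one, Matrix.cons_val_two, Matrix.head_cons, Matrix.tail_cons, Int.cast_neg,
        Int.cast_ofNat]
      rw [ha, hb, ht]; field_simp; ring
    · show ((2 * h / 3) • intVec ![1, -2, -2] + eqFrame h (WithLp.toLp 2 ![a, b, t])) 2 = x 2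
      rw [PiLp.add_apply, e2]
      simp only [PiLp.smul_apply, smul_eq_mul, intVec_apply, Matrix.cons_val_zero,
        Matrix.cons_val_one, Matrix.cons_val_two, Matrix.head_cons, Matrix.tail_cons, Int.cast_neg,
        Int.cast_ofNat]
      rw [ha, hb]; field_simp; ring

end

end Summit.AtomisticToContinuum.Crystallization.Theorems.OverbindingBudgetAffineFarFieldCellFacetsTRD
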